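import Summits.NavierStokesRegularity.NavierStokesRegularity.Theorems.OddMorawetzOddMorawetzLocalAssemblyLemmas
import Summits.NavierStokesRegularity.NavierStokesRegularity.Theorems.OddMorawetzOddMorawetzLocalNullReduction
import Summits.NavierStokesRegularity.NavierStokesRegularity.Theorems.OddMorawetzOddMorawetzLocalTauEqSumIso
import HarnessLib

/-!
# Crux `OddMorawetzLocal` (stmt-NavierStokesRegularity-1376) — reduction to the live isotropic densities

Generic (weight-independent) core of the refutation's assembly (line `registered`, lead c1). For an `O(3)`-fixed
coefficient vector `τ` (the certificate density after isotropic reduction), given the kernel certificates in abstract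
form — the orbit-sum identities `he`, the reconstruction checks `hrec`, the certified kernel `hker` of the derivation
system, the kinds of the isotropic descriptors (live ones first, then divergences and ideal members), canonicity of
their monomials, the flux orders and the ideal certificates — the Morawetz pairing of `τ` at every divergence-free
Schwartz field is a FIXED real combination of the pairings of the live densities only:
`morawetzPairing k v τ = Σ_{l < nlive} γ_l · morawetzPairing k v (isoPolyF iso_l)`.
(`tau_eq_sum_iso` + linearity + `morawetzPairing_vecOf_eq_zero` for the non-live basis elements.)
Everything is proved; no definitions; no named facts.
-/

noncomputable section

set_option linter.dupNamespace false

namespace Summit.NavierStokesRegularity.NavierStokesRegularity.Theorems.OddMorawetz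

open MeasureTheory Literature.Analysis.FluidPDE

/-- A non-live isotropic basis polynomial (divergence of an isotropic flux with jets of order `≤ 3`, or an ideal
member with certificate) has vanishing Morawetz pairing. -/
theorem morawetzPairing_isoPolyF_eq_zero (k : ℕ) (v : EuclideanSpace ℝ (Fin 3) → EuclideanSpace ℝ (Fin 3))
    (hv : IsSchwartzField v) (hd : VectorCalculus.IsDivFree v) (q : IsoDesc)
    (hcan : ∀ t ∈ isoPolyF q, t.2 ∈ idx k)
    (hkind : (∃ sh mt, q = IsoDesc.null sh mt) ∨ (∃ sh mt, q = IsoDesc.ideal sh mt))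
    (hflux : ∀ sh mt, q = IsoDesc.null sh mt →
      ∀ F ∈ [isoFlux sh mt 0, isoFlux sh mt 1, isoFlux sh mt 2], ∀ t ∈ F, ∀ u ∈ t.2, u.2.length ≤ 3)
    (hideal : ∀ sh mt, q = IsoDesc.ideal sh mt → nfKillsF (isoPolyF (.ideal sh mt)) = true) :
    morawetzPairing k v (fun i => ((vecOf k (isoPolyF q) i : ℤ) : ℝ)) = 0 := by
  refine morawetzPairing_vecOf_eq_zero k v hv hd (isoPolyF q) hcan (isoPolyF_pairwise_ne q) ?_
  rcases hkind with ⟨sh, mt, rfl⟩ | ⟨sh, mt, rfl⟩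
  · refine Or.inl ⟨isoFlux sh mt 0, isoFlux sh mt 1, isoFlux sh mt 2, hflux sh mt rfl, fun ξ => ?_⟩
    exact JPoly.evalA_normF_intCast _ ξ
  · exact Or.inr (hideal sh mt rfl)

/-- **Reduction to the live densities.** See the module docstring. The conclusion keeps all `d` basis indices and
zeroes the non-live ones, so that each weight extracts its live terms by `Fin.sum_univ_succ`. -/
theorem live_reduction (k : ℕ) (τ : V k)
    (hfix : ∀ G ∈ Matrix.unitaryGroup (Fin 3) ℝ, (actMatrix k (G : Matrix (Fin 3) (Fin 3) ℝ)).mulVec τ = τ)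
    (reps : List (List JVar)) (hr : ∀ m ∈ reps, m ∈ idx k)
    (he : ∀ i : Fin (idx k).length, orbitSum ((idx k).get i) = [] ∨
      ∃ (r : ℕ) (c : ℤ), r < reps.length ∧ reps.getD r [] = (minImage ((idx k).get i)).2 ∧
        orbitSum ((idx k).get i) = JPoly.smul c (orbitSumN (reps.getD r [])))
    (iso : List IsoDesc) (d : ℕ) (hd : iso.length = d)
    (hrec : ∀ q ∈ iso, orbitReconF reps (isoPolyF q) = true)
    (hker : ∀ c : Fin reps.length → ℝ, ((aMatrix k reps).map (Int.cast : ℤ → ℝ)).mulVec c = 0 →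
      ∃ γ : Fin d → ℝ, c = ∑ l, γ l • fun r => ((sVecD reps iso d l r : ℤ) : ℝ))
    (nlive : ℕ)
    (hkind : ∀ j, nlive ≤ j → j < d →
      (∃ sh mt, iso.getD j (.poly []) = IsoDesc.null sh mt) ∨ (∃ sh mt, iso.getD j (.poly []) = IsoDesc.ideal sh mt))
    (hcan : ∀ q ∈ iso, ∀ t ∈ isoPolyF q, t.2 ∈ idx k)
    (hflux : ∀ sh mt, IsoDesc.null sh mt ∈ iso →
      ∀ F ∈ [isoFlux sh mt 0, isoFlux sh mt 1, isoFlux sh mt 2], ∀ t ∈ F, ∀ u ∈ t.2, u.2.length ≤ 3)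
    (hideal : ∀ sh mt, IsoDesc.ideal sh mt ∈ iso → nfKillsF (isoPolyF (.ideal sh mt)) = true) :
    ∃ γ : Fin d → ℝ, ∀ v, IsSchwartzField v → VectorCalculus.IsDivFree v →
      morawetzPairing k v τ = ∑ l : Fin d, if l.val < nlive then
        γ l * morawetzPairing k v (fun i => ((vecOf k (isoPolyF (iso.getD l.val (.poly []))) i : ℤ) : ℝ)) else 0 := by
  obtain ⟨γ, hτ⟩ := tau_eq_sum_iso k τ hfix reps hr he iso d hd hrec hker
  refine ⟨γ, fun v hv hdv => ?_⟩
  rw [hτ, morawetzPairing_sum_smul k v hv hdv Finset.univ γ]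
  refine Finset.sum_congr rfl fun l _ => ?_
  split_ifs with hl
  · rfl
  · have hj : nlive ≤ l.val := Nat.le_of_not_lt hl
    have hlt : l.val < iso.length := hd ▸ l.isLt
    have hmem : iso.getD l.val (.poly []) ∈ iso := by
      rw [List.getD_eq_getElem _ _ hlt]
      exact List.getElem_mem hlt
    rw [morawetzPairing_isoPolyF_eq_zero k v hv hdv (iso.getD l.val (.poly [])) (hcan _ hmem)
      (hkind l.val hj (hd ▸ hlt)) (fun sh mt hq => hflux sh mt (hq ▸ hmem)) (fun sh mt hq => hideal sh mt (hq ▸ hmem)),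
      mul_zero]

end Summit.NavierStokesRegularity.NavierStokesRegularity.Theorems.OddMorawetz

end
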